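import Mathlib
import Summits.ValiantsHypothesis.ValiantsHypothesis.Theorems.ValuativeGCTValuativeFlipRayStability
import Literature.NumberTheory.DiophantineGeometry.KroneckerMonotone
import Literature.Computability.Complexity.OccurrenceObstructionsIPSemigroup
import HarnessLib

/-!
# `ValuativeGCT.ValuativeFlip` (stmt-ValiantsHypothesis-12624): ray stability, IV — the Kronecker
# majorant is monotone at EVERY step and stable from the SHARP threshold (Manivel's theorem in full)

Wall-breaker k16 (axis "representation-stability transfer between `m` and `m + 1`"), companion of
`…RayStability`.  Letters as there; `g(j) := g(μ♯(n+j), (n+j)×δ, (n+j)×δ)`.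

File I recorded `g(j+1) ≤ g(j)` beyond the body threshold `|μ̄| ≤ n + j` (Manivel's stability, upper
half, `kroneckerCoeff_rowLift_succ_le` of the Literature) and hence eventual constancy.  The LOWER half
is the monotonicity of the Kronecker coefficients under the semigroup operation
(`kroneckerCoeff_le_of_ofPartition_add`, `Literature/…/KroneckerMonotone.lean`: `g(λ, μ, ν) ≤
g(λ+λ', μ+μ', ν+ν')` whenever `g(λ', μ', ν') > 0`), applied to the positive one-row triple
`((δ), 1^δ, 1^δ)` in the transposed (`δ` rows) orientation:

* `kroneckerCoeff_le_rowAdd` — the semigroup monotonicity in `rowAdd` form (the `≤`-version of the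
  named fact `ikenmeyerPanova2017_semigroup`);
* `kroneckerCoeff_le_rowAdd_row` — adding the one-row triple `((kM), k×M, k×M)`:
  `g(λ, k×b, k×b) ≤ g(λ + (kM), k×(b+M), k×(b+M))` (the `≤`-version of IP's constant move
  `kroneckerCoeff_pos_rowAdd_row`);
* **`kronecker_ray_mono_up`** — `g(j) ≤ g(j+1)` for EVERY `j` (no threshold), hence `g(j₁) ≤ g(j)` for
  all `j₁ ≤ j` (`kronecker_ray_mono`);
* **`kronecker_ray_const_from_body`** — `g(j) = g(J₀)` for all `j ≥ J₀ := |μ̄| - n` (both halves):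
  Manivel's Thm. 1 / IP17 Thm. 2.1 in full, "`g(ρ(md), m×d, m×d)` is constant for `m ≥ |ρ|`"; in
  particular for `|μ̄| ≤ n` the Kronecker ray is CONSTANT FROM THE START
  (`kronecker_ray_const_of_bodySize_le`);
* `kronecker_ray_le_rayLimit` — `g(j) ≤ g∞(μ)` for EVERY `j` (like `K ≤ K∞`, `a ≤ a∞`, `P ≤ P∞`).

[Manivel, J. Algebraic Combin. 33 (2011) Thm. 1 and §1; Ikenmeyer–Panova 2017 Thm. 2.1, §1.1;
Christandl–Harrow–Mitchison 2007; Vallejo 1999; this crux's `…RayStability`]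
-/

set_option linter.dupNamespace false

namespace Summit.ValiantsHypothesis.ValiantsHypothesis.Theorems.ValuativeFlip

open Literature.NumberTheory.DiophantineGeometry
open Literature.Computability.AlgebraicComplexity
open Literature.Computability.Complexity

noncomputable section

/-! ## §1 Semigroup monotonicity in `rowAdd` form and the one-row move -/

/-- **Monotonicity of the Kronecker coefficients, `rowAdd` form**: for `λ, μ, ν ⊢ a` and
`λ', μ', ν' ⊢ b` with `g(λ', μ', ν') > 0`, `g(λ, μ, ν) ≤ g(λ + λ', μ + μ', ν + ν')` (the `≤`-version of
the semigroup property `ikenmeyerPanova2017_semigroup_holds`; bookkeeping as there: all partitions have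
at most `a + b` parts, and the weight of a row-wise sum is the sum of the weights).
[Manivel 2011 §1; Christandl–Harrow–Mitchison 2007; Ikenmeyer–Panova 2017 §1.1] -/
theorem kroneckerCoeff_le_rowAdd {a b : ℕ} (lam mu nu : Nat.Partition a) (lam' mu' nu' : Nat.Partition b)
    (h' : 0 < kroneckerCoeff ℂ lam' mu' nu') :
    kroneckerCoeff ℂ lam mu nu ≤ kroneckerCoeff ℂ (lam.rowAdd lam') (mu.rowAdd mu') (nu.rowAdd nu') := by
  have ha : ∀ ρ : Nat.Partition a, ρ.parts.card ≤ a + b := fun ρ =>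
    ρ.card_parts_le_size.trans (Nat.le_add_right a b)
  have hb : ∀ ρ : Nat.Partition b, ρ.parts.card ≤ a + b := fun ρ =>
    ρ.card_parts_le_size.trans (Nat.le_add_left b a)
  have hab : ∀ (ρ : Nat.Partition a) (ρ' : Nat.Partition b), (ρ.rowAdd ρ').parts.card ≤ a + b :=
    fun ρ ρ' => (card_parts_rowAdd_le ρ ρ').trans (max_le (ha ρ) (hb ρ'))
  exact kroneckerCoeff_le_of_ofPartition_add (k := ℂ) (a + b) (ha lam) (ha mu) (ha nu) (hb lam')
    (hb mu') (hb nu') (hab lam lam') (hab mu mu') (hab nu nu') (ofPartition_rowAdd _ lam lam')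
    (ofPartition_rowAdd _ mu mu') (ofPartition_rowAdd _ nu nu') h'

/-- **Adding the one-row triple `((kM), k×M, k×M)` does not decrease `g`**:
`g(λ, k×b, k×b) ≤ g(λ + (kM), k×(b+M), k×(b+M))` (the `≤`-version of IP's constant move
`kroneckerCoeff_pos_rowAdd_row`: `g((kM), k×M, k×M) ≥ 1` by `kroneckerCoeff_indiscrete_pos`, then
`kroneckerCoeff_le_rowAdd` and `k×b + k×M = k×(b+M)`). [Ikenmeyer–Panova 2017 Lemma 4.2 (proof);
Manivel 2011 §1] -/
theorem kroneckerCoeff_le_rowAdd_row {k b M : ℕ} (lam : Nat.Partition (k * b))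
    (mu : Nat.Partition (k * (b + M)))
    (hmu : mu.parts = (lam.rowAdd (Nat.Partition.indiscrete (k * M))).parts) :
    kroneckerCoeff ℂ lam (Nat.Partition.rectangle k b) (Nat.Partition.rectangle k b) ≤
      kroneckerCoeff ℂ mu (Nat.Partition.rectangle k (b + M)) (Nat.Partition.rectangle k (b + M)) := by
  have h2 : 0 < kroneckerCoeff ℂ (Nat.Partition.indiscrete (k * M))
      (Nat.Partition.rectangle k M) (Nat.Partition.rectangle k M) :=
    kroneckerCoeff_indiscrete_pos ℂ _
  have h3 := kroneckerCoeff_le_rowAdd lam (Nat.Partition.rectangle k b) (Nat.Partition.rectangle k b)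
    _ _ _ h2
  have hp := rowAdd_rectangle_parts k b M
  rwa [kroneckerCoeff_congr_parts (Nat.mul_add k b M).symm (lam' := mu)
    (mu' := Nat.Partition.rectangle k (b + M)) (nu' := Nat.Partition.rectangle k (b + M)) hmu.symm
    hp hp] at h3

/-! ## §2 Bookkeeping: retyping partitions, weights of equal parts -/

/-- A partition of `D` is a partition of any `D' = D` with the same parts. [folklore] -/
theorem exists_partition_parts_eq {D D' : ℕ} (lam : Nat.Partition D) (h : D = D') :
    ∃ lam' : Nat.Partition D', lam'.parts = lam.parts := by
  subst h
  exact ⟨lam, rfl⟩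

/-- Partitions with the same parts have the same weight. [folklore] -/
theorem ofPartition_congr_parts (N : ℕ) {D D' : ℕ} {lam : Nat.Partition D} {lam' : Nat.Partition D'}
    (h : lam.parts = lam'.parts) : Weight.ofPartition N lam = Weight.ofPartition N lam' := by
  funext i
  rw [Weight.ofPartition_apply, Weight.ofPartition_apply]
  simp only [Nat.Partition.sortedParts, h]

/-- **The next row lift is the previous one plus the one-row partition `(δ)`** (in parts): if
`L ⊢ δ(n+j)` has the parts of `μ♯(n+j)`, then `μ♯(n+j+1)` has the parts of `L + (δ·1)`.
[folklore] -/
theorem parts_rowLift_succ_eq_rowAdd {n δ : ℕ} (μ : Nat.Partition (n * δ)) (j : ℕ)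
    (L : Nat.Partition (δ * (n + j))) (hL : L.parts = (rowLift μ j).parts) :
    (rowLift μ (j + 1)).parts = (L.rowAdd (Nat.Partition.indiscrete (δ * 1))).parts := by
  haveI : NeZero (μ.parts.card + 1) := ⟨Nat.succ_ne_zero _⟩
  have hc1 : (rowLift μ (j + 1)).parts.card ≤ μ.parts.card + 1 :=
    (card_parts_rowLift_le μ (j + 1)).trans (max_le (Nat.le_succ _) (by omega))
  have hcL : L.parts.card ≤ μ.parts.card + 1 := by
    rw [hL]
    exact (card_parts_rowLift_le μ j).trans (max_le (Nat.le_succ _) (by omega))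
  have hc2 : (L.rowAdd (Nat.Partition.indiscrete (δ * 1))).parts.card ≤ μ.parts.card + 1 := by
    refine (card_parts_rowAdd_le L _).trans (max_le hcL ?_)
    rcases Nat.eq_zero_or_pos (δ * 1) with h0 | hpos
    · rw [h0]; simp
    · rw [Nat.Partition.indiscrete_parts hpos.ne']; simp
  refine parts_eq_of_ofPartition_eq (N := μ.parts.card + 1) ?_ hc1 hc2
  rw [ofPartition_rowAdd, ofPartition_congr_parts _ hL, ofPartition_rowLift, ofPartition_rowLift,
    ofPartition_indiscrete, add_assoc, ← Pi.single_add]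
  congr 2
  push_cast
  ring

/-! ## §3 The Kronecker ray is non-decreasing at every step -/

/-- **`g(j) ≤ g(j+1)` for every `j`**: `g(μ♯(n+j), (n+j)×δ, (n+j)×δ) ≤ g(μ♯(n+j+1), (n+j+1)×δ, (n+j+1)×δ)`
with NO threshold — transpose both rectangles to `δ` rows (`kroneckerCoeff_rectangle_transpose`), add
the positive one-row triple `((δ), 1^δ, 1^δ)` (`kroneckerCoeff_le_rowAdd_row` with `M = 1`), and
transpose back. [Manivel 2011 §1 (monotonicity); Ikenmeyer–Panova 2017 §1.1] -/
theorem kronecker_ray_mono_up (n δ : ℕ) (μ : Nat.Partition (n * δ)) (j : ℕ) :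
    kroneckerCoeff ℂ (rowLift μ j) (Nat.Partition.rectangle (n + j) δ) (Nat.Partition.rectangle (n + j) δ) ≤
      kroneckerCoeff ℂ (rowLift μ (j + 1)) (Nat.Partition.rectangle (n + (j + 1)) δ)
        (Nat.Partition.rectangle (n + (j + 1)) δ) := by
  obtain ⟨L, hL⟩ := exists_partition_parts_eq (rowLift μ j) (Nat.mul_comm (n + j) δ)
  obtain ⟨L1, hL1⟩ := exists_partition_parts_eq (rowLift μ (j + 1))
    (show (n + (j + 1)) * δ = δ * (n + j + 1) by ring)
  rw [kroneckerCoeff_rectangle_transpose (rowLift μ j) L hL.symm,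
    kroneckerCoeff_rectangle_transpose (rowLift μ (j + 1)) L1 hL1.symm]
  exact kroneckerCoeff_le_rowAdd_row (k := δ) (b := n + j) (M := 1) L L1
    (hL1.trans (parts_rowLift_succ_eq_rowAdd μ j L hL))

/-- **The Kronecker ray is non-decreasing**: `g(j₁) ≤ g(j)` for all `j₁ ≤ j`. [Manivel 2011 §1] -/
theorem kronecker_ray_mono (n δ : ℕ) (μ : Nat.Partition (n * δ)) {j₁ j : ℕ} (hj : j₁ ≤ j) :
    kroneckerCoeff ℂ (rowLift μ j₁) (Nat.Partition.rectangle (n + j₁) δ) (Nat.Partition.rectangle (n + j₁) δ) ≤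
      kroneckerCoeff ℂ (rowLift μ j) (Nat.Partition.rectangle (n + j) δ) (Nat.Partition.rectangle (n + j) δ) := by
  induction j, hj using Nat.le_induction with
  | base => exact le_rfl
  | succ j _ ih => exact ih.trans (kronecker_ray_mono_up n δ μ j)

/-! ## §4 Manivel's stability theorem in full: constant from the sharp threshold -/

/-- **`g(j) = g(j+1)` beyond the body threshold** (`|μ̄| ≤ n + j`): the two monotonicities
`kronecker_ray_mono_up` (semigroup) and `kronecker_ray_step` (Manivel, file I) meet.
[Manivel 2011 Thm. 1; Ikenmeyer–Panova 2017 Thm. 2.1] -/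
theorem kronecker_ray_succ_eq (n δ : ℕ) (μ : Nat.Partition (n * δ)) (j : ℕ) (hj : bodySize μ ≤ n + j) :
    kroneckerCoeff ℂ (rowLift μ (j + 1)) (Nat.Partition.rectangle (n + (j + 1)) δ)
        (Nat.Partition.rectangle (n + (j + 1)) δ) =
      kroneckerCoeff ℂ (rowLift μ j) (Nat.Partition.rectangle (n + j) δ) (Nat.Partition.rectangle (n + j) δ) :=
  le_antisymm (kronecker_ray_step n δ μ j hj) (kronecker_ray_mono_up n δ μ j)

/-- **MANIVEL'S STABILITY OF RECTANGULAR KRONECKER COEFFICIENTS, BOTH HALVES**: along the ray of an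
inner shape `μ ⊢ nδ`, `g(μ♯(n+j), (n+j)×δ, (n+j)×δ) = g(μ♯(n+J₀), (n+J₀)×δ, (n+J₀)×δ)` for every
`j ≥ J₀ := |μ̄| - n` — the ray is CONSTANT from the sharp threshold `n + j ≥ |μ̄|` (Manivel: "`k_ρ(d, n)`
is constant for `d ≥ |ρ|`"; IP17 Thm. 2.1: "`(n, d) ∈ St¹(ρ)` … in particular if `n ≥ |ρ|`").  The tree
had the upper half (`kroneckerCoeff_rowLift_le`); the lower half is the semigroup monotonicity.
[Manivel 2011 Thm. 1; Ikenmeyer–Panova 2017 Thm. 2.1; Vallejo 1999] -/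
theorem kronecker_ray_const_from_body (n δ : ℕ) (μ : Nat.Partition (n * δ)) {j : ℕ}
    (hj : bodySize μ - n ≤ j) :
    kroneckerCoeff ℂ (rowLift μ j) (Nat.Partition.rectangle (n + j) δ) (Nat.Partition.rectangle (n + j) δ) =
      kroneckerCoeff ℂ (rowLift μ (bodySize μ - n)) (Nat.Partition.rectangle (n + (bodySize μ - n)) δ)
        (Nat.Partition.rectangle (n + (bodySize μ - n)) δ) := by
  induction j, hj using Nat.le_induction with
  | base => rfl
  | succ j hj ih => rw [← ih]; exact kronecker_ray_succ_eq n δ μ j (by omega)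

/-- **The Manivel-stable case from the start**: if `|μ̄| ≤ n` then
`g(μ♯(n+j), (n+j)×δ, (n+j)×δ) = g(μ, n×δ, n×δ)` for EVERY `j` (IP17 Thm. 2.1 with `(n, d) ∈ St¹(λ̄)`
for all `n ≥ |λ̄|`, now an equality in the tree; the previous `kroneckerCoeff_rowLift_le` was `≤`).
[Ikenmeyer–Panova 2017 Thm. 2.1; Manivel 2011 Thm. 1] -/
theorem kronecker_ray_const_of_bodySize_le (n δ : ℕ) (μ : Nat.Partition (n * δ)) (hμ : bodySize μ ≤ n)
    (j : ℕ) :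
    kroneckerCoeff ℂ (rowLift μ j) (Nat.Partition.rectangle (n + j) δ) (Nat.Partition.rectangle (n + j) δ) =
      kroneckerCoeff ℂ μ (Nat.Partition.rectangle n δ) (Nat.Partition.rectangle n δ) :=
  le_antisymm (kroneckerCoeff_rowLift_le μ hμ j)
    ((kroneckerCoeff_rectangle_congr_level (show n = n + 0 by ring) μ (rowLift μ 0)
      (parts_rowLift_zero μ).symm).le.trans (kronecker_ray_mono n δ μ (Nat.zero_le j)))

/-- **Every value of the Kronecker ray is dominated by its stable value**: for any eventual value
`g∞` of the ray (`kronecker_rayStable`), `g(j) ≤ g∞` for EVERY `j` (the ray is non-decreasing) — so all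
four rays of the axis (`P`, `K`, `a`, `g`) are dominated everywhere by their limits.
[Manivel 2011 §1; this file] -/
theorem kronecker_ray_le_rayLimit (n δ : ℕ) (μ : Nat.Partition (n * δ)) {G : ℕ}
    (hG : ∃ j₀ : ℕ, ∀ j : ℕ, j₀ ≤ j →
      kroneckerCoeff ℂ (rowLift μ j) (Nat.Partition.rectangle (n + j) δ) (Nat.Partition.rectangle (n + j) δ) = G)
    (j : ℕ) :
    kroneckerCoeff ℂ (rowLift μ j) (Nat.Partition.rectangle (n + j) δ) (Nat.Partition.rectangle (n + j) δ) ≤ G := by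
  obtain ⟨j₀, hj₀⟩ := hG
  rw [← hj₀ (max j₀ j) (le_max_left _ _)]
  exact kronecker_ray_mono n δ μ (le_max_right _ _)

/-- **The stable value of the Kronecker ray is attained exactly from `n + j ≥ |μ̄|`** (sharp form of
`kronecker_rayStable`): with `J₀ = |μ̄| - n`, `g(j) = g(J₀)` for all `j ≥ J₀` and `g(j) ≤ g(J₀)` for all
`j`. [Manivel 2011 Thm. 1; Ikenmeyer–Panova 2017 Thm. 2.1] -/
theorem kronecker_rayStable_sharp (n δ : ℕ) (μ : Nat.Partition (n * δ)) :
    (∀ j : ℕ, bodySize μ - n ≤ j →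
      kroneckerCoeff ℂ (rowLift μ j) (Nat.Partition.rectangle (n + j) δ) (Nat.Partition.rectangle (n + j) δ) =
        kroneckerCoeff ℂ (rowLift μ (bodySize μ - n)) (Nat.Partition.rectangle (n + (bodySize μ - n)) δ)
          (Nat.Partition.rectangle (n + (bodySize μ - n)) δ)) ∧
    (∀ j : ℕ,
      kroneckerCoeff ℂ (rowLift μ j) (Nat.Partition.rectangle (n + j) δ) (Nat.Partition.rectangle (n + j) δ) ≤
        kroneckerCoeff ℂ (rowLift μ (bodySize μ - n)) (Nat.Partition.rectangle (n + (bodySize μ - n)) δ)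
          (Nat.Partition.rectangle (n + (bodySize μ - n)) δ)) :=
  ⟨fun _ hj => kronecker_ray_const_from_body n δ μ hj,
    fun j => kronecker_ray_le_rayLimit n δ μ ⟨bodySize μ - n, fun _ hj => kronecker_ray_const_from_body n δ μ hj⟩ j⟩

end

end Summit.ValiantsHypothesis.ValiantsHypothesis.Theorems.ValuativeFlip
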